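import Literature.NumberTheory.EllipticCurves.ZpExtensionShapiroToEisensteinHom
import Literature.NumberTheory.EllipticCurves.ZpExtensionKolyvaginPrimesShapiroEisensteinProofs
import Literature.NumberTheory.EllipticCurves.ZpExtensionShapiroKolyvaginSystemSmul
import Literature.NumberTheory.EllipticCurves.LambdaAdicSelmerDataToEisensteinH1Linear
import Literature.NumberTheory.GaloisCohomology.Howard2004.KolyvaginSystemReindex
import Literature.NumberTheory.GaloisCohomology.Howard2004.TowerMorphismPushforward
import HarnessLib

/-!
# The pushforward of a Kolyvagin system along `S_Λ.reindex σ → (T_𝔮, F_𝔮, 𝓛_E)` and its bottom classes; the CGLS Heegner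
# point Kolyvagin system pushed into Howard's Eisenstein specialisation: `κ′_k = proj_{k+1} (control map of κ_∞)` (theorems only)

Topic `NumberTheory/EllipticCurves` (sequel of `ZpExtensionShapiroToEisensteinHom` (THE `Hom`, G5b), `ZpExtensionKolyvaginPrimes
ShapiroEisensteinProofs` (`𝓛_E ⊆ 𝓛₀(T_𝔮)`), lit's `ZpExtensionShapiroKolyvaginSystemSmul` (CGLS Thm. 4.1.1 normalised: `κ.one = Φ′(z)`)
and Howard's `KolyvaginSystemReindex` / `TowerMorphismPushforward` (`KolyvaginSystem.reindex`, `DVRSetting.KolyvaginSystem.ofHom`)).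
Cell `pub/bsd-print-x9`, seat `bsd-line-x9-p2` g4: the KS conjunct of STUB A (`stub_howardInputs` / D1's `Stmt.ksLink`) of the shared
μ-crux, ASSEMBLED up to the two remaining inputs it does not own (`κ′.one ≠ 0` on the target — x10b-p1-w2's C8 — and the
`SatisfiesH` witness `hy`, D1's), i.e. an integration certificate that lit's source, the `Hom`, Howard's `reindex`/`ofHom` and the LINK
compose in the kernel with all instance arguments aligned.
* `WeierstrassCurve.exists_kolyvaginSystem_ofHom_one_eq` — any Kolyvagin system `κ` on lit's `S_Λ` (levels guard) pushes to one on
  D1's `eisensteinDVRSettingLevelsTame` with `κ′_k = H¹(f_k) (κ_{σ k})` (Howard, proof of Thm. 2.2.10, first map).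
* **`WeierstrassCurve.exists_eisensteinKolyvaginSystem_one_eq_proj`** — from the (F-411) fact (CGLS Thm. 4.1.1 by name) and every
  choice of the presentation slots: a Kolyvagin system `κ′` on `(T_𝔮, F_𝔮, 𝓛_E)` at `m` with
  `κ′_k = proj_{k+1} (toEisensteinH1Linear κ_∞)` for all `k` — the `∀ k, κKS.one k = ctrlLevel … z k` clause of `Stmt.ksLink`
  verbatim (`ctrlLevel` unfolded), with `S = {v ∣ pN}`, `𝓛 = 𝓛_E`, `t = (p ·)`, `ht = rfl`.
Theorems only; no named fact (the (F-411) fact enters as a HYPOTHESIS `h411`), no instance, no notation, no `sorry`.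
BSD is not proved by any of this.

References: [Howard2004HeegnerKolyvagin] Rem. 1.2.4, §1.6, proof of Thm. 2.2.10 (arXiv p. 7 L13–27, p. 12 L29–33, p0017 L78–81);
[CastellaGrossiLeeSkinner2022] Thm. 4.1.1, Rem. 4.1.4, §3.2 (𝓛_E), §3.4.
-/

noncomputable section

open scoped TensorProduct Topology Classical ContRepresentation
open Field CategoryTheory IsLocalRing IsDedekindDomain
open scoped NumberField

namespace WeierstrassCurve

open Literature.NumberTheory.EllipticCurves Literature.NumberTheory.GaloisRepresentations
open Literature.NumberTheory.GaloisRepresentations.DiscreteGaloisModule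
open Literature.NumberTheory.GaloisCohomology.Howard2004
open Literature.NumberTheory.EllipticCurves.ZpExtension

variable {K : Type} [Field K] [NumberField K] (W : WeierstrassCurve ℚ) [W.IsElliptic] {p : ℕ} [hp : Fact p.Prime]
  (κ : ZpExtension K p) {m : ℕ} (hm : 1 ≤ m)
  (π : ∀ v : HeightOneSpectrum (𝓞 K), TamePin v)

section Push

variable (S : Finset (HeightOneSpectrum (𝓞 K)))
  (hpS : ∀ v : HeightOneSpectrum (𝓞 K), ((p : ℕ) : 𝓞 K) ∈ v.asIdeal → v ∈ S)
  (hbad : ∀ v : HeightOneSpectrum (𝓞 K), v ∉ S → ((p : ℕ) : 𝓞 K) ∉ v.asIdeal → (W.baseChange K).HasGoodReductionAt v)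
  (L : Set (HeightOneSpectrum (𝓞 K))) (hL : L ⊆ (W.shapiroTower K p κ).degreeTwoPrimes p)
  (hLt : letI := IwasawaAlgebra.isLocalRing_quotient_X_pow_add_C p hm
    L ⊆ (W.eisensteinTower κ hm).degreeTwoPrimes p)
  (hLS : ∀ v ∈ L, v ∉ S)
  (jbar : AlgebraicClosure K →+* ℂ) (cd : ConjugationDatum K)
  (πbar : letI := W.shapiroResidueModule K p
    ∀ j, W.ShapiroLevel K p j →ₗ[IwasawaAlgebra p ⧸ shapiroIdeal p (j + 1)] geomTorsion (W.baseChange K) (p : ℤ))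
  (D : ∀ j, DualityDatum p cd ((W.shapiroTower K p κ).ρ j) (IwasawaAlgebra p ⧸ shapiroIdeal p (j + 1)))
  (cdt : ConjugationDatum K)
  (Dt : letI := IwasawaAlgebra.isLocalRing_quotient_X_pow_add_C p hm
    ∀ k, DualityDatum p cdt ((W.eisensteinTower κ hm).ρ k) (IwasawaAlgebra.EisensteinCoeff p m (k + 1)))
  (s₀ : ℕ) (d : ℕ → ℕ)
  (hadm : ∀ k σ, idxSeq s₀ d k + 1 ≤ σ → k + 1 ≤ σ ∧
    shapiroIdeal p σ ≤ Ideal.span {(PowerSeries.X ^ m + PowerSeries.C (p : ℤ_[p]) : IwasawaAlgebra p)} ⊔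
      Ideal.span {PowerSeries.C ((p : ℤ_[p]) ^ (k + 1))})
  (hS : ∀ v ∈ S, ((p : ℕ) : 𝓞 K) ∉ v.asIdeal → ∃ c : ℕ, ∀ i, 1 ≤ i → ∀ x : galoisCohomology
    ((κ.eisensteinTwist ((W.baseChange K).torsionGaloisModule ((p : ℤ) ^ i)) hm i).toLocal (Sum.inr v)) 1, p ^ c • x = 0)

set_option synthInstance.maxHeartbeats 80000 in
/-- The level triples of the re-indexed `S_Λ` carry its prime set `𝓛` (the hypothesis `hL` of `KolyvaginSystem.ofHom`).
[cite: Howard2004HeegnerKolyvagin, §2.3 (arXiv p0018 L65) and §1.6] -/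
theorem shapiroSettingTame_reindex_t_primes (k : ℕ) :
    letI := W.shapiroResidueModule K p
    (((W.shapiroSettingTame κ π (fun n v ↦ n ∈ levels L ∧ v ∈ n)
        (W.shapiroTameHyp_of_mem_levels κ S hpS hbad L hL hLS) S hpS hbad L hL hLS jbar cd πbar D).reindex s₀ d).t k).primes =
      ((W.shapiroSettingTame κ π (fun n v ↦ n ∈ levels L ∧ v ∈ n)
        (W.shapiroTameHyp_of_mem_levels κ S hpS hbad L hL hLS) S hpS hbad L hL hLS jbar cd πbar D).reindex s₀ d).L := by
  letI := W.shapiroResidueModule K p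
  rw [CoeffTowerSetting.reindex_t, (CoeffTowerSetting.reindex_jbar _ s₀ d).2.1]
  exact W.shapiroSetting_t_primes κ S hpS hbad L hL hLS jbar cd πbar D _ (idxSeq s₀ d k)

set_option synthInstance.maxHeartbeats 80000 in
/-- **Pushforward of a Kolyvagin system along THE `Hom`** (Howard, proof of Thm. 2.2.10, first map «`KS(𝐓, 𝓕_Λ, 𝓛) → KS(T_𝔭, 𝓕_𝔭, 𝓛)`»):
a Kolyvagin system on lit's `S_Λ` (tame slots on the levels guard) restricts to the cofinal sub-tower `σ = idxSeq s₀ d`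
(`KolyvaginSystem.reindex`) and pushes forward (`DVRSetting.KolyvaginSystem.ofHom`) to a Kolyvagin system on D1's
`eisensteinDVRSettingLevelsTame`, given `SatisfiesH` of the target; its bottom classes are `κ′_k = H¹(f_k) (κ_{σ k})`.
[cite: Howard2004HeegnerKolyvagin, proof of Thm. 2.2.10 (arXiv p0017 L78–81), Rem. 1.2.4 and §1.6] -/
theorem exists_kolyvaginSystem_ofHom_one_eq
    (κsrc : letI := W.shapiroResidueModule K p
      (W.shapiroSettingTame κ π (fun n v ↦ n ∈ levels L ∧ v ∈ n)
        (W.shapiroTameHyp_of_mem_levels κ S hpS hbad L hL hLS) S hpS hbad L hL hLS jbar cd πbar D).KolyvaginSystem)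
    (hy :
    letI := IwasawaAlgebra.isDomain_quotient_X_pow_add_C p hm
    letI := IwasawaAlgebra.isDiscreteValuationRing_quotient_X_pow_add_C p hm
    haveI := IwasawaAlgebra.EisensteinCoeff.isLocalRing_succ p hm
    letI := IwasawaAlgebra.EisensteinCoeff.algebraOfSpecSucc p m
    haveI := W.isScalarTower_algebraOfSpecSucc (K := K) (p := p) (m := m)
    letI := W.residueModuleSucc (K := K) (p := p) hm
    letI := W.shapiroResidueModule K p
    (W.eisensteinDVRSettingLevelsTame κ hm π S hpS hbad L hLt hLS jbar cdt Dt).SatisfiesH) :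
    letI := IwasawaAlgebra.isDomain_quotient_X_pow_add_C p hm
    letI := IwasawaAlgebra.isDiscreteValuationRing_quotient_X_pow_add_C p hm
    haveI := IwasawaAlgebra.EisensteinCoeff.isLocalRing_succ p hm
    letI := IwasawaAlgebra.EisensteinCoeff.algebraOfSpecSucc p m
    haveI := W.isScalarTower_algebraOfSpecSucc (K := K) (p := p) (m := m)
    letI := W.residueModuleSucc (K := K) (p := p) hm
    letI := W.shapiroResidueModule K p
    ∃ κKS : (W.eisensteinDVRSettingLevelsTame κ hm π S hpS hbad L hLt hLS jbar cdt Dt).KolyvaginSystem,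
      ∀ k, κKS.one k = (W.shapiroToEisensteinHom κ hm π S hpS hbad L hL hLt hLS jbar cd πbar D cdt Dt s₀ d hadm hS).fH1 k (κsrc.one (idxSeq s₀ d k)) := by
  letI := IwasawaAlgebra.isDomain_quotient_X_pow_add_C p hm
  letI := IwasawaAlgebra.isDiscreteValuationRing_quotient_X_pow_add_C p hm
  haveI := IwasawaAlgebra.EisensteinCoeff.isLocalRing_succ p hm
  letI := IwasawaAlgebra.EisensteinCoeff.algebraOfSpecSucc p m
  haveI := W.isScalarTower_algebraOfSpecSucc (K := K) (p := p) (m := m)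
  letI := W.residueModuleSucc (K := K) (p := p) hm
  letI := W.shapiroResidueModule K p
  refine ⟨DVRSetting.KolyvaginSystem.ofHom
    (W.shapiroToEisensteinHom κ hm π S hpS hbad L hL hLt hLS jbar cd πbar D cdt Dt s₀ d hadm hS)
    (W.shapiroSettingTame_reindex_t_primes κ π S hpS hbad L hL hLS jbar cd πbar D s₀ d) hy
    (κsrc.reindex s₀ d), fun k ↦ ?_⟩
  exact DVRSetting.KolyvaginSystem.ofHom_one _ _ hy _ k

end Push

/-! ## The CGLS Heegner point Kolyvagin system in Howard's Eisenstein specialisation -/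

section CGLS

variable {N : ℕ} [NeZero N] [W.IsGloballyMinimal] {γ : absoluteGaloisGroup K}

set_option synthInstance.maxHeartbeats 80000 in
/-- **`κ′ ∈ KS(T_𝔮, F_𝔮, 𝓛_E)` with `κ′_k = proj_{k+1} (toEisensteinH1Linear κ_∞)`** — the KS clause of STUB A: from the (F-411)
fact (CGLS Thm. 4.1.1 + Rem. 4.1.4 by name, `h411`), normalised by lit to `κ.one = Φ′(z)` for `z = κ_∞`, restricted to an
admissible cofinal sub-tower (`exists_idxSeq_adm`) and pushed along THE `Hom` into D1's `eisensteinDVRSettingLevelsTame` at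
`S = {v ∣ pN}`, `𝓛 = 𝓛_E` (`𝓛_E ⊆ 𝓛₀(T_𝔮)` by `heegnerKolyvaginPrimes_subset_degreeTwoPrimes_eisensteinTower`), the SAME pin `π`
and embedding `jbar`, source duality data at any ONE `cd`, target data `(cdt, Dt)` arbitrary; the bottom classes are computed by
the LINK (`shapiroToEisensteinHom_fH1_toShapiroSuccLimitH1`).  Remaining hypotheses: the (N1) local torsion bound `hS` at the
places of `S` prime to `p` (x9-p1-w4 g5) and `SatisfiesH` of the target (`hy`, D1).  `κ′.one ≠ 0` is NOT asserted here (C8).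
[cite: CastellaGrossiLeeSkinner2022, Thm. 4.1.1 and Rem. 4.1.4 (arXiv v2 TeX L2203–2206, L2291–2294)] [cite: Howard2004HeegnerKolyvagin, proof of Thm. 2.2.10 (arXiv p0017 L78–81)] -/
theorem exists_eisensteinKolyvaginSystem_one_eq_proj
    (h411 : CastellaGrossiLeeSkinner2022.thm411_exists_kolyvaginSystem_one_ne_zero)
    (hyp : CastellaGrossiLeeSkinner2022.Thm413Hypotheses N W K p κ γ) (jbar : AlgebraicClosure K →+* ℂ)
    (Dsel : (W.baseChange K).LambdaAdicSelmerData κ γ) (C : CastellaGrossiLeeSkinner2022.StabilizedHeegnerData N W K κ jbar)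
    (z : Dsel.S) (hz : ∀ (k : ℕ) (hk : C.depth < k), Dsel.proj k z ∈ CastellaGrossiLeeSkinner2022.stabilizedClassLayer C k hk)
    (cd : ConjugationDatum K)
    (πbar : letI := W.shapiroResidueModule K p
      ∀ j, W.ShapiroLevel K p j →ₗ[IwasawaAlgebra p ⧸ shapiroIdeal p (j + 1)] geomTorsion (W.baseChange K) (p : ℤ))
    (Dsrc : ∀ j, DualityDatum p cd ((W.shapiroTower K p (κ.unitTwist (-1))).ρ j) (IwasawaAlgebra p ⧸ shapiroIdeal p (j + 1)))
    (cdt : ConjugationDatum K)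
    (Dt : letI := IwasawaAlgebra.isLocalRing_quotient_X_pow_add_C p hm
      ∀ k, DualityDatum p cdt ((W.eisensteinTower (κ.unitTwist (-1)) hm).ρ k) (IwasawaAlgebra.EisensteinCoeff p m (k + 1)))
    (I : ZpExtension.EisensteinH1Data (κ.unitTwist (-1)) (fun k ↦ (W.baseChange K).torsionGaloisModule ((p : ℤ) ^ k)) (fun j ↦ (W.baseChange K).torsionGaloisModuleReduce p j) hm)
    (hS : ∀ v ∈ (CastellaGrossiLeeSkinner2022.placesDividing K (p * N) CastellaGrossiLeeSkinner2022.mul_level_ne_zero),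
      ((p : ℕ) : 𝓞 K) ∉ v.asIdeal → ∃ c : ℕ, ∀ i, 1 ≤ i → ∀ x : galoisCohomology
        (((κ.unitTwist (-1)).eisensteinTwist ((W.baseChange K).torsionGaloisModule ((p : ℤ) ^ i)) hm i).toLocal (Sum.inr v)) 1,
        p ^ c • x = 0)
    (hy :
    letI := IwasawaAlgebra.isDomain_quotient_X_pow_add_C p hm
    letI := IwasawaAlgebra.isDiscreteValuationRing_quotient_X_pow_add_C p hm
    haveI := IwasawaAlgebra.EisensteinCoeff.isLocalRing_succ p hm
    letI := IwasawaAlgebra.EisensteinCoeff.algebraOfSpecSucc p m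
    haveI := W.isScalarTower_algebraOfSpecSucc (K := K) (p := p) (m := m)
    letI := W.residueModuleSucc (K := K) (p := p) hm
    letI := W.shapiroResidueModule K p
    (W.eisensteinDVRSettingLevelsTame (κ.unitTwist (-1)) hm π
      (CastellaGrossiLeeSkinner2022.placesDividing K (p * N) CastellaGrossiLeeSkinner2022.mul_level_ne_zero)
      (fun _ hv ↦ CastellaGrossiLeeSkinner2022.mem_placesDividing_of_dvd CastellaGrossiLeeSkinner2022.mul_level_ne_zero
      (dvd_mul_right p N) hv)
      (fun _ hv _ ↦ CastellaGrossiLeeSkinner2022.hasGoodReductionAt_of_not_mem_placesDividing W hyp.level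
      CastellaGrossiLeeSkinner2022.mul_level_ne_zero hv)
      (CastellaGrossiLeeSkinner2022.heegnerKolyvaginPrimes W (κ.unitTwist (-1))
      (CastellaGrossiLeeSkinner2022.placesDividing K (p * N) CastellaGrossiLeeSkinner2022.mul_level_ne_zero))
      (W.heegnerKolyvaginPrimes_subset_degreeTwoPrimes_eisensteinTower (κ.unitTwist (-1)) hm (κ.unitTwist (-1))
      (CastellaGrossiLeeSkinner2022.placesDividing K (p * N) CastellaGrossiLeeSkinner2022.mul_level_ne_zero)
      (fun _ hv _ ↦ CastellaGrossiLeeSkinner2022.hasGoodReductionAt_of_not_mem_placesDividing W hyp.level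
      CastellaGrossiLeeSkinner2022.mul_level_ne_zero hv))
      (fun _ hv ↦ CastellaGrossiLeeSkinner2022.not_mem_of_mem_heegnerKolyvaginPrimes W (κ.unitTwist (-1)) _ hv) jbar cdt Dt).SatisfiesH) :
    letI := IwasawaAlgebra.isDomain_quotient_X_pow_add_C p hm
    letI := IwasawaAlgebra.isDiscreteValuationRing_quotient_X_pow_add_C p hm
    haveI := IwasawaAlgebra.EisensteinCoeff.isLocalRing_succ p hm
    letI := IwasawaAlgebra.EisensteinCoeff.algebraOfSpecSucc p m
    haveI := W.isScalarTower_algebraOfSpecSucc (K := K) (p := p) (m := m)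
    letI := W.residueModuleSucc (K := K) (p := p) hm
    letI := W.shapiroResidueModule K p
    ∃ κKS : (W.eisensteinDVRSettingLevelsTame (κ.unitTwist (-1)) hm π
      (CastellaGrossiLeeSkinner2022.placesDividing K (p * N) CastellaGrossiLeeSkinner2022.mul_level_ne_zero)
      (fun _ hv ↦ CastellaGrossiLeeSkinner2022.mem_placesDividing_of_dvd CastellaGrossiLeeSkinner2022.mul_level_ne_zero
      (dvd_mul_right p N) hv)
      (fun _ hv _ ↦ CastellaGrossiLeeSkinner2022.hasGoodReductionAt_of_not_mem_placesDividing W hyp.level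
      CastellaGrossiLeeSkinner2022.mul_level_ne_zero hv)
      (CastellaGrossiLeeSkinner2022.heegnerKolyvaginPrimes W (κ.unitTwist (-1))
      (CastellaGrossiLeeSkinner2022.placesDividing K (p * N) CastellaGrossiLeeSkinner2022.mul_level_ne_zero))
      (W.heegnerKolyvaginPrimes_subset_degreeTwoPrimes_eisensteinTower (κ.unitTwist (-1)) hm (κ.unitTwist (-1))
      (CastellaGrossiLeeSkinner2022.placesDividing K (p * N) CastellaGrossiLeeSkinner2022.mul_level_ne_zero)
      (fun _ hv _ ↦ CastellaGrossiLeeSkinner2022.hasGoodReductionAt_of_not_mem_placesDividing W hyp.level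
      CastellaGrossiLeeSkinner2022.mul_level_ne_zero hv))
      (fun _ hv ↦ CastellaGrossiLeeSkinner2022.not_mem_of_mem_heegnerKolyvaginPrimes W (κ.unitTwist (-1)) _ hv) jbar cdt Dt).KolyvaginSystem,
      ∀ k, κKS.one k = I.proj (k + 1) (Dsel.toEisensteinH1Linear hm (fun j ↦ (W.baseChange K).torsionGaloisModuleReduce p j) (fun _ _ ↦ rfl) I
        hyp.topGenerator hyp.noPTorsion z) := by
  letI := IwasawaAlgebra.isDomain_quotient_X_pow_add_C p hm
  letI := IwasawaAlgebra.isDiscreteValuationRing_quotient_X_pow_add_C p hm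
  haveI := IwasawaAlgebra.EisensteinCoeff.isLocalRing_succ p hm
  letI := IwasawaAlgebra.EisensteinCoeff.algebraOfSpecSucc p m
  haveI := W.isScalarTower_algebraOfSpecSucc (K := K) (p := p) (m := m)
  letI := W.residueModuleSucc (K := K) (p := p) hm
  letI := W.shapiroResidueModule K p
  obtain ⟨s₀, d, -, hadm⟩ := exists_idxSeq_adm p (m := m) hm
  obtain ⟨κsrc, hone, -⟩ := CastellaGrossiLeeSkinner2022.exists_kolyvaginSystem_one_eq h411 hyp Dsel C z hz π
    (fun n v ↦ n ∈ levels (CastellaGrossiLeeSkinner2022.heegnerKolyvaginPrimes W (κ.unitTwist (-1))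
      (CastellaGrossiLeeSkinner2022.placesDividing K (p * N) CastellaGrossiLeeSkinner2022.mul_level_ne_zero)) ∧ v ∈ n)
    (W.shapiroTameHyp_of_mem_levels (κ.unitTwist (-1)) (CastellaGrossiLeeSkinner2022.placesDividing K (p * N) CastellaGrossiLeeSkinner2022.mul_level_ne_zero)
      (fun _ hv ↦ CastellaGrossiLeeSkinner2022.mem_placesDividing_of_dvd CastellaGrossiLeeSkinner2022.mul_level_ne_zero
      (dvd_mul_right p N) hv)
      (fun _ hv _ ↦ CastellaGrossiLeeSkinner2022.hasGoodReductionAt_of_not_mem_placesDividing W hyp.level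
      CastellaGrossiLeeSkinner2022.mul_level_ne_zero hv)
      (CastellaGrossiLeeSkinner2022.heegnerKolyvaginPrimes W (κ.unitTwist (-1))
      (CastellaGrossiLeeSkinner2022.placesDividing K (p * N) CastellaGrossiLeeSkinner2022.mul_level_ne_zero))
      (CastellaGrossiLeeSkinner2022.heegnerKolyvaginPrimes_subset_degreeTwoPrimes W (κ.unitTwist (-1)) _)
      (fun _ hv ↦ CastellaGrossiLeeSkinner2022.not_mem_of_mem_heegnerKolyvaginPrimes W (κ.unitTwist (-1)) _ hv))
    (fun n hn v hv ↦ ⟨hn, hv⟩) cd πbar Dsrc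
  obtain ⟨κKS, hKS⟩ := W.exists_kolyvaginSystem_ofHom_one_eq (κ.unitTwist (-1)) hm π (CastellaGrossiLeeSkinner2022.placesDividing K (p * N) CastellaGrossiLeeSkinner2022.mul_level_ne_zero)
    (fun _ hv ↦ CastellaGrossiLeeSkinner2022.mem_placesDividing_of_dvd CastellaGrossiLeeSkinner2022.mul_level_ne_zero
      (dvd_mul_right p N) hv)
    (fun _ hv _ ↦ CastellaGrossiLeeSkinner2022.hasGoodReductionAt_of_not_mem_placesDividing W hyp.level
      CastellaGrossiLeeSkinner2022.mul_level_ne_zero hv)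
    (CastellaGrossiLeeSkinner2022.heegnerKolyvaginPrimes W (κ.unitTwist (-1))
      (CastellaGrossiLeeSkinner2022.placesDividing K (p * N) CastellaGrossiLeeSkinner2022.mul_level_ne_zero))
    (CastellaGrossiLeeSkinner2022.heegnerKolyvaginPrimes_subset_degreeTwoPrimes W (κ.unitTwist (-1)) _)
    (W.heegnerKolyvaginPrimes_subset_degreeTwoPrimes_eisensteinTower (κ.unitTwist (-1)) hm (κ.unitTwist (-1))
      (CastellaGrossiLeeSkinner2022.placesDividing K (p * N) CastellaGrossiLeeSkinner2022.mul_level_ne_zero)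
      (fun _ hv _ ↦ CastellaGrossiLeeSkinner2022.hasGoodReductionAt_of_not_mem_placesDividing W hyp.level
      CastellaGrossiLeeSkinner2022.mul_level_ne_zero hv))
    (fun _ hv ↦ CastellaGrossiLeeSkinner2022.not_mem_of_mem_heegnerKolyvaginPrimes W (κ.unitTwist (-1)) _ hv) jbar cd πbar Dsrc cdt Dt s₀ d hadm hS κsrc hy
  refine ⟨κKS, fun k ↦ (hKS k).trans ((congrArg _ (congrFun hone (idxSeq s₀ d k))).trans ?_)⟩
  exact W.shapiroToEisensteinHom_fH1_toShapiroSuccLimitH1 (κ := κ) (hm := hm) (π := π) (S := (CastellaGrossiLeeSkinner2022.placesDividing K (p * N) CastellaGrossiLeeSkinner2022.mul_level_ne_zero))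
    (hpS := (fun _ hv ↦ CastellaGrossiLeeSkinner2022.mem_placesDividing_of_dvd CastellaGrossiLeeSkinner2022.mul_level_ne_zero
      (dvd_mul_right p N) hv))
    (hbad := (fun _ hv _ ↦ CastellaGrossiLeeSkinner2022.hasGoodReductionAt_of_not_mem_placesDividing W hyp.level
      CastellaGrossiLeeSkinner2022.mul_level_ne_zero hv))
    (L := (CastellaGrossiLeeSkinner2022.heegnerKolyvaginPrimes W (κ.unitTwist (-1))
      (CastellaGrossiLeeSkinner2022.placesDividing K (p * N) CastellaGrossiLeeSkinner2022.mul_level_ne_zero)))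
    (hLS := (fun _ hv ↦ CastellaGrossiLeeSkinner2022.not_mem_of_mem_heegnerKolyvaginPrimes W (κ.unitTwist (-1)) _ hv)) (jbar := jbar) (cd := cd) (cdt := cdt) (s₀ := s₀) (d := d) (hadm := hadm)
    (Dsel := Dsel) (hγ := hyp.topGenerator) (hE := hyp.noPTorsion)
    (hL' := (CastellaGrossiLeeSkinner2022.heegnerKolyvaginPrimes_subset_degreeTwoPrimes W (κ.unitTwist (-1)) _))
    (hLt' := (W.heegnerKolyvaginPrimes_subset_degreeTwoPrimes_eisensteinTower (κ.unitTwist (-1)) hm (κ.unitTwist (-1))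
      (CastellaGrossiLeeSkinner2022.placesDividing K (p * N) CastellaGrossiLeeSkinner2022.mul_level_ne_zero)
      (fun _ hv _ ↦ CastellaGrossiLeeSkinner2022.hasGoodReductionAt_of_not_mem_placesDividing W hyp.level
      CastellaGrossiLeeSkinner2022.mul_level_ne_zero hv)))
    (πbar' := πbar) (D' := Dsrc) (Dt' := Dt) (hS' := hS) (I := I) (k := k) (z := z)

end CGLS

end WeierstrassCurve

end
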